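import Summits.CriticalPhenomena.PercolationContinuityZ3.Theorems.PercNearOneGluingNoHeavyLowerTailCumulativeIsolation
import Summits.CriticalPhenomena.PercolationContinuityZ3.Theorems.PercNearOneGluingNoHeavyLowerTailOneCutModulus
import Summits.CriticalPhenomena.PercolationContinuityZ3.Theorems.PercNearOneGluingNoHeavyLowerTailKNConj4AllWeights
import HarnessLib

/-!
# `NoHeavyLowerTail` (stmt-CriticalPhenomena-4575) — the one-cut engine stubs and the geometric-moment CIL, discharged

Support file (`--supports stmt-CriticalPhenomena-4575`), prover `prim-ineq-gen-6` (gen 10).  No definitions, no named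
facts, no sorries; standard axioms.

With the cumulative isolation lemma a tree theorem (`CIL.stub_cumulativeIsolation`, this seat, from Kozma–Nitzan's
Conjecture 4 `Q7Psi.kn_conj4_designated`), the remaining ENGINE stubs registered on the crux by the one-cut line and the
engine seat are corollaries; this file discharges them by name and signature:

* `stub_fatMinorityLinear` (planner skeleton r2; `d₀ = 0`, `C = 2`) — `fatMinorityLinear_of_cumulativeIsolation` fed with
  CIL at level `⌊|A|/2⌋`;
* `stub_oneCutConst` (cplus-engine; `C = 2`, `ρ₀ = 1/2`) — `P(1 ≤ N < E N / 2) ≤ P(1 ≤ N ≤ ⌊|A|/2⌋) ≤ P(2|π(a)| ≤ |A|) ≤ 2t`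
  by CIL and pair counting (`smallBlock_le_two_mul`), WITHOUT the observer budget `P(o ↮ A)`;
* `stub_oneCutModulus` (cplus-engine g2) — `oneCut_modulus_of_oneCut_const stub_oneCutConst`;
* `stub_geometricMomentCIL` (lead gen 4, with the SHARP constant `C = 1`) — Conjecture 4 (`PreFKGSurplus.kn_conj4`, all
  weights) for the monotone cluster property `F(S) = −v^{|S ∩ A|}`, `0 < v ≤ 1`:
  `Σ_{j ≥ 1} v^j P(N = j) = E[v^N; o ↔ A] ≤ E[v^{|π(a)|}; o ↔ A] ≤ E v^{|π(a)|} = Σ_j v^j P(|π(a)| = j)`.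
[cite: KozmaNitzan2024, Conjecture 4 (p. 32), Lemma 2 (p. 6)]
-/

noncomputable section

namespace Summit.CriticalPhenomena.PercolationContinuityZ3.Theorems

open MeasureTheory Set Literature.Probability.LatticeModels Literature.Probability.Percolation
open scoped Classical

namespace OneCutStubs

/-- CIL at the half level `j = ⌊|A|/2⌋`, in the `2N ≤ |A|` spelling consumed by the one-cut reductions. [this work] -/
theorem cil_half :
    ∀ (n : ℕ) (w : Sym2 (Fin n) → unitInterval) (A : Finset (Fin n)) (o : Fin n),
      A.Nonempty → o ∉ A → ∃ a ∈ A,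
        (prodBernoulli w).real {ω : BondConfig (Fin n) |
            1 ≤ (A.filter fun x => ω ∈ openConn o x).card ∧
              2 * (A.filter fun x => ω ∈ openConn o x).card ≤ A.card} ≤
          (prodBernoulli w).real {ω : BondConfig (Fin n) |
            2 * (A.filter fun x => ω ∈ openConn a x).card ≤ A.card} := by
  intro n w A o hA ho
  obtain ⟨a, ha, hle⟩ := CIL.stub_cumulativeIsolation n w A o (A.card / 2) hA ho
  refine ⟨a, ha, ?_⟩
  have e1 : {ω : BondConfig (Fin n) |
      1 ≤ (A.filter fun x => ω ∈ openConn o x).card ∧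
        2 * (A.filter fun x => ω ∈ openConn o x).card ≤ A.card} =
      {ω : BondConfig (Fin n) |
        1 ≤ (A.filter fun x => ω ∈ openConn o x).card ∧
          (A.filter fun x => ω ∈ openConn o x).card ≤ A.card / 2} := by
    ext ω; simp only [Set.mem_setOf_eq]; omega
  have e2 : {ω : BondConfig (Fin n) | 2 * (A.filter fun x => ω ∈ openConn a x).card ≤ A.card} =
      {ω : BondConfig (Fin n) | (A.filter fun x => ω ∈ openConn a x).card ≤ A.card / 2} := by
    ext ω; simp only [Set.mem_setOf_eq]; omega
  rw [e1, e2]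
  exact hle

/-- **Registered stub `stub_fatMinorityLinear` (planner skeleton r2), verbatim** (`d₀ = 0`, `C = 2`):
`P(d₀ < N ∧ 2N ≤ |A|) ≤ C·(P(o ↮ A) + η)` under pairwise `η`-reliability of `A` — CIL at the half level and pair
counting (`fatMinorityLinear_of_cumulativeIsolation`). [this work] [cite: KozmaNitzan2024, Lemma 2 (p. 6)] -/
theorem stub_fatMinorityLinear :
    ∃ (d₀ : ℕ) (C : ℝ), 0 ≤ C ∧ ∀ (n : ℕ) (w : Sym2 (Fin n) → unitInterval) (A : Finset (Fin n)) (o : Fin n)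
      (η : ℝ), 0 ≤ η → o ∉ A →
      (∀ a ∈ A, ∀ a' ∈ A, (Literature.Probability.LatticeModels.prodBernoulli w).real
        (Literature.Probability.Percolation.openConn a a')ᶜ ≤ η) →
      (Literature.Probability.LatticeModels.prodBernoulli w).real
          {ω : Literature.Probability.Percolation.BondConfig (Fin n) |
            d₀ < (A.filter fun a => ω ∈ Literature.Probability.Percolation.openConn o a).card ∧
              2 * (A.filter fun a => ω ∈ Literature.Probability.Percolation.openConn o a).card ≤ A.card} ≤
        C * ((Literature.Probability.LatticeModels.prodBernoulli w).real
          (⋃ a ∈ A, Literature.Probability.Percolation.openConn o a)ᶜ + η) :=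
  fatMinorityLinear_of_cumulativeIsolation cil_half

/-- `E N ≤ |A|`. [folklore] -/
theorem expectedCount_le_card {n : ℕ} (w : Sym2 (Fin n) → unitInterval) (A : Finset (Fin n)) (o : Fin n) :
    (∑ a ∈ A, (prodBernoulli w).real (openConn o a : Set (BondConfig (Fin n)))) ≤ (A.card : ℝ) := by
  calc (∑ a ∈ A, (prodBernoulli w).real (openConn o a : Set (BondConfig (Fin n))))
      ≤ ∑ _a ∈ A, (1 : ℝ) := Finset.sum_le_sum fun a _ => measureReal_le_one
    _ = A.card := by rw [Finset.sum_const, nsmul_eq_mul, mul_one]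

/-- **Registered stub `stub_oneCutConst` (cplus-engine), verbatim** with `C = 2`, `ρ₀ = 1/2`: the linear one-cut bound
`P(1 ≤ N ∧ N < E N / 2) ≤ 2t` whenever all pairwise disconnections among distinct relays are `≤ t` (no observer
budget needed).  `N < E N/2 ≤ |A|/2` puts the event inside `{1 ≤ N ≤ ⌊|A|/2⌋}`, CIL bounds it by `P(2|π(a)| ≤ |A|)` for
some relay `a`, and pair counting (`smallBlock_le_two_mul`) by `2t`. [this work]
[cite: KozmaNitzan2024, Lemma 2 (p. 6), Conjecture 4 (p. 32)] -/
theorem stub_oneCutConst :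
    ∃ (C ρ₀ : ℝ), 0 < ρ₀ ∧ ∀ (n : ℕ) (w : Sym2 (Fin n) → unitInterval) (A : Finset (Fin n)) (o : Fin n) (t : ℝ),
      0 ≤ t → (∀ a ∈ A, ∀ a' ∈ A, a ≠ a' → (Literature.Probability.LatticeModels.prodBernoulli w).real
        (Literature.Probability.Percolation.openConn a a')ᶜ ≤ t) →
      (Literature.Probability.LatticeModels.prodBernoulli w).real
          {ω : Literature.Probability.Percolation.BondConfig (Fin n) |
            1 ≤ (A.filter fun a => ω ∈ Literature.Probability.Percolation.openConn o a).card ∧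
              ((A.filter fun a => ω ∈ Literature.Probability.Percolation.openConn o a).card : ℝ) <
                ρ₀ * (∑ a ∈ A, (Literature.Probability.LatticeModels.prodBernoulli w).real
                  (Literature.Probability.Percolation.openConn o a))} ≤ C * t := by
  refine ⟨2, 1 / 2, by norm_num, fun n w A o t ht hpair => ?_⟩
  set μ := prodBernoulli w with hμ
  haveI : IsProbabilityMeasure μ := by rw [hμ]; infer_instance
  set EN : ℝ := ∑ a ∈ A, μ.real (openConn o a : Set (BondConfig (Fin n))) with hEN
  have hENle : EN ≤ (A.card : ℝ) := expectedCount_le_card w A o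
  -- the engine event sits inside the CIL event at the half level
  have hsub : {ω : BondConfig (Fin n) | 1 ≤ (A.filter fun a => ω ∈ openConn o a).card ∧
        ((A.filter fun a => ω ∈ openConn o a).card : ℝ) < 1 / 2 * EN} ⊆
      {ω : BondConfig (Fin n) | 1 ≤ (A.filter fun x => ω ∈ openConn o x).card ∧
        2 * (A.filter fun x => ω ∈ openConn o x).card ≤ A.card} := by
    intro ω hω
    refine ⟨hω.1, ?_⟩
    have h2 : (2 * ((A.filter fun a => ω ∈ openConn o a).card : ℝ)) < (A.card : ℝ) := by linarith [hω.2]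
    have h3 : 2 * (A.filter fun a => ω ∈ openConn o a).card < A.card := by exact_mod_cast h2
    exact h3.le
  by_cases hoA : o ∈ A
  · -- `o ∈ A`: then `o ∈ π(o)` and every other relay is `t`-reliably joined to `o`; pair counting at `a := o`
    have h2 := smallBlock_le_two_mul w A o t hoA (fun a' ha' => ?_)
    · calc μ.real {ω : BondConfig (Fin n) | 1 ≤ (A.filter fun a => ω ∈ openConn o a).card ∧
              ((A.filter fun a => ω ∈ openConn o a).card : ℝ) < 1 / 2 * EN}
          ≤ μ.real {ω : BondConfig (Fin n) | 2 * (A.filter fun x => ω ∈ openConn o x).card ≤ A.card} :=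
            measureReal_mono (fun ω hω => (hsub hω).2) (measure_ne_top μ _)
        _ ≤ 2 * t := h2
    · by_cases hoa : o = a'
      · subst hoa
        have hempty : (openConn o o : Set (BondConfig (Fin n)))ᶜ = ∅ := by
          rw [Set.compl_empty_iff]
          exact Set.eq_univ_iff_forall.2 fun _ => SimpleGraph.Reachable.refl o
        rw [hempty, measureReal_empty]
        exact ht
      · exact hpair o hoA a' ha' hoa
  rcases A.eq_empty_or_nonempty with hAe | hAne
  · have hempty : {ω : BondConfig (Fin n) | 1 ≤ (A.filter fun a => ω ∈ openConn o a).card ∧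
        ((A.filter fun a => ω ∈ openConn o a).card : ℝ) < 1 / 2 * EN} = ∅ := by
      ext ω
      simp [hAe]
    rw [hempty, measureReal_empty]
    linarith
  obtain ⟨a, ha, hle⟩ := cil_half n w A o hAne hoA
  have h2 := smallBlock_le_two_mul w A a t ha (fun a' ha' => ?_)
  · calc μ.real {ω : BondConfig (Fin n) | 1 ≤ (A.filter fun a => ω ∈ openConn o a).card ∧
            ((A.filter fun a => ω ∈ openConn o a).card : ℝ) < 1 / 2 * EN}
        ≤ μ.real {ω : BondConfig (Fin n) | 1 ≤ (A.filter fun x => ω ∈ openConn o x).card ∧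
            2 * (A.filter fun x => ω ∈ openConn o x).card ≤ A.card} :=
          measureReal_mono hsub (measure_ne_top μ _)
      _ ≤ μ.real {ω : BondConfig (Fin n) | 2 * (A.filter fun x => ω ∈ openConn a x).card ≤ A.card} := hle
      _ ≤ 2 * t := h2
  · by_cases haa : a = a'
    · subst haa
      have hempty : (openConn a a : Set (BondConfig (Fin n)))ᶜ = ∅ := by
        rw [Set.compl_empty_iff]
        exact Set.eq_univ_iff_forall.2 fun _ => SimpleGraph.Reachable.refl a
      rw [hempty, measureReal_empty]
      exact ht
    · exact hpair a ha a' ha' haa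

/-- **Registered stub `stub_oneCutModulus` (cplus-engine g2), verbatim**: one-cut with a modulus —
`oneCut_modulus_of_oneCut_const stub_oneCutConst`. [this work] [cite: KozmaNitzan2024, Conjecture 4 (p. 32)] -/
theorem stub_oneCutModulus :
    ∀ ε : ℝ, 0 < ε → ∃ (ρ τ : ℝ), 0 < ρ ∧ 0 < τ ∧ ∀ (n : ℕ) (w : Sym2 (Fin n) → unitInterval) (A : Finset (Fin n))
      (o : Fin n), (∀ a ∈ A, ∀ a' ∈ A, a ≠ a' → (Literature.Probability.LatticeModels.prodBernoulli w).real
        (Literature.Probability.Percolation.openConn a a')ᶜ ≤ τ) →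
      (Literature.Probability.LatticeModels.prodBernoulli w).real
        (⋃ a ∈ A, (Literature.Probability.Percolation.openConn o a :
          Set (Literature.Probability.Percolation.BondConfig (Fin n))))ᶜ ≤ τ →
      (Literature.Probability.LatticeModels.prodBernoulli w).real
          {ω : Literature.Probability.Percolation.BondConfig (Fin n) |
            1 ≤ (A.filter fun a => ω ∈ Literature.Probability.Percolation.openConn o a).card ∧
              ((A.filter fun a => ω ∈ Literature.Probability.Percolation.openConn o a).card : ℝ) <
                ρ * (∑ a ∈ A, (Literature.Probability.LatticeModels.prodBernoulli w).real
                  (Literature.Probability.Percolation.openConn o a))} ≤ ε :=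
  oneCut_modulus_of_oneCut_const stub_oneCutConst

/-! ### The geometric-moment CIL (sharp constant) -/

/-- Fibre decomposition of `g(K(ω))` for a finset-valued count `K ≤ k`: pointwise
`g (K ω) = Σ_{j ∈ range (k+1)} 1{K ω = j}·g j`. [folklore] -/
theorem apply_eq_sum_ite {Ω : Type*} (K : Ω → ℕ) (k : ℕ) (hK : ∀ ω, K ω ≤ k) (g : ℕ → ℝ) (ω : Ω) :
    g (K ω) = ∑ j ∈ Finset.range (k + 1), (if K ω = j then g j else 0) := by
  rw [Finset.sum_ite_eq]
  rw [if_pos (Finset.mem_range.2 (Nat.lt_succ_of_le (hK ω)))]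

/-- `E[g(K); E] = Σ_{j ≤ k} g(j)·μ({K = j} ∩ E)` for a count `K ≤ k` on the finite configuration space. [folklore] -/
theorem setIntegral_apply_count {n : ℕ} (μ : Measure (BondConfig (Fin n))) [IsFiniteMeasure μ]
    (K : BondConfig (Fin n) → ℕ) (k : ℕ) (hK : ∀ ω, K ω ≤ k) (g : ℕ → ℝ) (E : Set (BondConfig (Fin n))) :
    ∫ ω in E, g (K ω) ∂μ =
      ∑ j ∈ Finset.range (k + 1), g j * μ.real ({ω : BondConfig (Fin n) | K ω = j} ∩ E) := by
  have hmeas : ∀ S : Set (BondConfig (Fin n)), MeasurableSet S := fun _ => MeasurableSet.of_discrete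
  have e : (fun ω => g (K ω)) = fun ω => ∑ j ∈ Finset.range (k + 1), (if K ω = j then g j else 0) := by
    funext ω; exact apply_eq_sum_ite K k hK g ω
  rw [e, integral_finsetSum _ (fun j _ => Integrable.of_finite)]
  refine Finset.sum_congr rfl fun j _ => ?_
  have e2 : (fun ω : BondConfig (Fin n) => if K ω = j then g j else 0) =
      {ω : BondConfig (Fin n) | K ω = j}.indicator (fun _ => g j) := by
    funext ω
    by_cases h : K ω = j
    · rw [if_pos h, Set.indicator_of_mem (show ω ∈ {ω : BondConfig (Fin n) | K ω = j} from h)]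
    · rw [if_neg h, Set.indicator_of_notMem (show ω ∉ {ω : BondConfig (Fin n) | K ω = j} from h)]
  rw [e2, setIntegral_indicator (hmeas _), setIntegral_const, smul_eq_mul, Set.inter_comm, mul_comm]

/-- **Registered stub `stub_geometricMomentCIL` (lead gen 4), verbatim, with the sharp constant `C = 1`**: for
`0 < v ≤ 1`, `A ≠ ∅`, `o ∉ A`, some relay `a ∈ A` has `Σ_{j=1}^{|A|} v^j P(N = j) ≤ Σ_{j=0}^{|A|} v^j P(|π(a)| = j)`.
Kozma–Nitzan's Conjecture 4 (`PreFKGSurplus.kn_conj4`, every weight vector) for `F(S) = −v^{|S ∩ A|}`. [this work]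
[cite: KozmaNitzan2024, Conjecture 4 (p. 32)] -/
theorem stub_geometricMomentCIL :
    ∃ C : ℝ, 0 ≤ C ∧ ∀ (n : ℕ) (w : Sym2 (Fin n) → unitInterval) (A : Finset (Fin n)) (o : Fin n) (v : ℝ),
      0 < v → v ≤ 1 → A.Nonempty → o ∉ A → ∃ a ∈ A,
        (∑ j ∈ Finset.Icc 1 A.card, v ^ j * (Literature.Probability.LatticeModels.prodBernoulli w).real
          {ω : Literature.Probability.Percolation.BondConfig (Fin n) |
            (A.filter fun x => ω ∈ Literature.Probability.Percolation.openConn o x).card = j}) ≤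
        C * ∑ j ∈ Finset.range (A.card + 1), v ^ j * (Literature.Probability.LatticeModels.prodBernoulli w).real
          {ω : Literature.Probability.Percolation.BondConfig (Fin n) |
            (A.filter fun x => ω ∈ Literature.Probability.Percolation.openConn a x).card = j} := by
  refine ⟨1, zero_le_one, fun n w A o v hv0 hv1 hA _ => ?_⟩
  set μ := prodBernoulli w with hμ
  haveI : IsProbabilityMeasure μ := by rw [hμ]; infer_instance
  have hmeas : ∀ S : Set (BondConfig (Fin n)), MeasurableSet S := fun _ => MeasurableSet.of_discrete
  -- the monotone cluster property `F(S) = -v^{|S ∩ A|}`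
  set F : Set (Fin n) → ℝ := fun S => -(v ^ (A.filter fun y => y ∈ S).card) with hF
  have hFmono : ∀ S T : Set (Fin n), S ⊆ T → F S ≤ F T := by
    intro S T hST
    have hsub : (A.filter fun y => y ∈ S) ⊆ (A.filter fun y => y ∈ T) :=
      Finset.monotone_filter_right A fun _ _ hy => hST hy
    have := pow_le_pow_of_le_one hv0.le hv1 (Finset.card_le_card hsub)
    simp only [hF]
    linarith
  obtain ⟨a, ha, h4⟩ := PreFKGSurplus.kn_conj4 w A o F hFmono hA
  refine ⟨a, ha, ?_⟩
  rw [one_mul]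
  set U : Set (BondConfig (Fin n)) := ⋃ a' ∈ A, (openConn o a' : Set (BondConfig (Fin n))) with hU
  -- counts
  set N : BondConfig (Fin n) → ℕ := fun ω => (A.filter fun x => ω ∈ openConn o x).card with hN
  set K : BondConfig (Fin n) → ℕ := fun ω => (A.filter fun x => ω ∈ openConn a x).card with hK
  have hNle : ∀ ω, N ω ≤ A.card := fun ω => Finset.card_filter_le _ _
  have hKle : ∀ ω, K ω ≤ A.card := fun ω => Finset.card_filter_le _ _
  -- `F (C_x ω) = -v^{count}` through `openConn`
  have hFo : ∀ ω, F (openCluster ω o) = -(v ^ N ω) := by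
    intro ω; simp only [hF, hN, CIL.filter_mem_openCluster]
  have hFa : ∀ ω, F (openCluster ω a) = -(v ^ K ω) := by
    intro ω; simp only [hF, hK, CIL.filter_mem_openCluster]
  simp only [hFo, hFa, integral_neg, neg_le_neg_iff] at h4
  rw [← hμ] at h4
  -- `h4 : ∫ ω in U, v ^ N ω ∂μ ≤ ∫ ω in U, v ^ K ω ∂μ`
  -- left side: `Σ_{j ∈ Icc 1 |A|} v^j μ(N = j) = ∫_U v^N`
  have hL : (∑ j ∈ Finset.Icc 1 A.card, v ^ j * μ.real {ω : BondConfig (Fin n) | N ω = j}) =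
      ∫ ω in U, v ^ N ω ∂μ := by
    rw [setIntegral_apply_count μ N A.card hNle (fun j => v ^ j) U]
    -- `{N = j} ∩ U = {N = j}` for `j ≥ 1`, `= ∅`-mass for `j = 0`
    rw [Finset.range_eq_Ico, ← Finset.insert_Ico_add_one_left_eq_Ico (Nat.succ_pos _)]
    rw [Finset.sum_insert (by simp), zero_add]
    have h0 : μ.real ({ω : BondConfig (Fin n) | N ω = 0} ∩ U) = 0 := by
      have : ({ω : BondConfig (Fin n) | N ω = 0} ∩ U) = ∅ := by
        ext ω
        simp only [Set.mem_inter_iff, Set.mem_setOf_eq, Set.mem_empty_iff_false, iff_false, not_and, hU,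
          CIL.mem_iUnion_openConn_iff, hN]
        intro h0; omega
      rw [this, measureReal_empty]
    rw [h0, mul_zero, zero_add]
    have hIcc : Finset.Ico 1 (A.card + 1) = Finset.Icc 1 A.card := by
      ext j; simp only [Finset.mem_Ico, Finset.mem_Icc]; omega
    rw [hIcc]
    refine Finset.sum_congr rfl fun j hj => ?_
    have hj1 : 1 ≤ j := (Finset.mem_Icc.1 hj).1
    congr 2
    ext ω
    simp only [Set.mem_inter_iff, Set.mem_setOf_eq, hU, CIL.mem_iUnion_openConn_iff, hN]
    constructor
    · intro h; exact ⟨h, by omega⟩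
    · intro h; exact h.1
  -- right side: `Σ_{j ∈ range (|A|+1)} v^j μ(K = j) = ∫ v^K ≥ ∫_U v^K`
  have hR : (∑ j ∈ Finset.range (A.card + 1), v ^ j * μ.real {ω : BondConfig (Fin n) | K ω = j}) =
      ∫ ω, v ^ K ω ∂μ := by
    rw [← setIntegral_univ, setIntegral_apply_count μ K A.card hKle (fun j => v ^ j) Set.univ]
    simp only [Set.inter_univ]
  have hRU : ∫ ω in U, v ^ K ω ∂μ ≤ ∫ ω, v ^ K ω ∂μ :=
    setIntegral_le_integral Integrable.of_finite (Filter.Eventually.of_forall fun ω => pow_nonneg hv0.le _)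
  change (∑ j ∈ Finset.Icc 1 A.card, v ^ j * μ.real {ω : BondConfig (Fin n) | N ω = j}) ≤
    ∑ j ∈ Finset.range (A.card + 1), v ^ j * μ.real {ω : BondConfig (Fin n) | K ω = j}
  rw [hL, hR]
  exact h4.trans hRU

end OneCutStubs

end Summit.CriticalPhenomena.PercolationContinuityZ3.Theorems

end
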